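import Summits.Ventures.PackingBounds.Configurations.ListConfig
import Mathlib.NumberTheory.Zsqrtd.ToReal
import Summits.Ventures.PackingBounds.Energy.UniversalOptimalityPolygon6

/-!
# The regular hexagon as an explicit configuration over `ℤ[√3]`: ground-state energy of `6` points on `S¹`

Framing: lottery ticket; floor = certified bounds/negative ranges. Venture `PackingBounds` (cell
`pub-packcert`, seat `pub-packcert-energy`) — the **attained side** for `(n, N) = (2, 6)`.

`vecs` lists the six vertices `(±2, 0), (±1, ±√3)` with coordinates in `ℤ[√3]` (`Zsqrtd 3`),
squared length `4`; the kernel checks the distance distribution `-1` (once), `∓1/2` (twice each). With the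
cell's universal optimality of the hexagon on `S¹` (`Energy.UniversalPolygon6…`, Chebyshev LP bound
`CircleEnergyLP`) this gives the ground-state energy of `6` points on the circle for every absolutely
monotonic potential (`energy_isLeast`).

## References
* H. Cohn, A. Kumar, J. Amer. Math. Soc. 20 (2007) 99–148, Table 1 (regular polygons). [`CohnKumar2006`]
-/

namespace Summit.Ventures.PackingBounds.Config.Hexagon

open Finset Summit.Ventures.PackingBounds.Config

/-- `0 ≤ 3`. -/
private theorem h3 : (0 : ℤ) ≤ 3 := by norm_num

/-- `3` is not a square. -/
private theorem d3_not_square : ∀ n : ℤ, (3 : ℤ) ≠ n * n := by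
  intro n h
  have h1 : n.natAbs * n.natAbs = 3 := by
    have := Int.natAbs_mul_self' n; omega
  have h2 : n.natAbs ≤ 2 := by nlinarith
  interval_cases n.natAbs <;> omega

/-- `(√3)² = 3`. -/
private theorem hX : Real.sqrt 3 ^ 2 = 3 := Real.sq_sqrt (by norm_num)

/-- `1.732 < √3`. -/
private theorem hlo : (1.732 : ℝ) < Real.sqrt 3 := (Real.lt_sqrt (by norm_num)).mpr (by norm_num)

/-- `√3 < 1.7321`. -/
private theorem hhi : Real.sqrt 3 < 1.7321 := (Real.sqrt_lt' (by norm_num)).mpr (by norm_num)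

set_option maxHeartbeats 4000000 in
/-- The hexagon vertices `(±2,0), (±1,±√3)` over `ℤ[√3]`. [cite: CohnKumar2006, Table 1] -/
def vecs : List (List (Zsqrtd 3)) := [
  [⟨2, 0⟩, ⟨0, 0⟩],
  [⟨-2, 0⟩, ⟨0, 0⟩],
  [⟨1, 0⟩, ⟨0, 1⟩],
  [⟨1, 0⟩, ⟨0, -1⟩],
  [⟨-1, 0⟩, ⟨0, 1⟩],
  [⟨-1, 0⟩, ⟨0, -1⟩]]

/-- The distance table: dot products of a member with the other members, with multiplicities. -/
def table : List ((Zsqrtd 3) × ℕ) := [(⟨-4, 0⟩, 1), (⟨-2, 0⟩, 2), (⟨2, 0⟩, 2)]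

/-- Kernel check: `6` coordinate lists. -/
theorem length_vecs : vecs.length = 6 := by decide +kernel

set_option maxRecDepth 100000 in
/-- Kernel check: every list has length `2` and the prescribed squared length. -/
private theorem shape_vecs : shapeOK vecs 2 (⟨4, 0⟩ : (Zsqrtd 3)) = true := by decide +kernel

/-- Kernel check: the table keys are distinct and differ from the squared length. -/
private theorem keys_table : keysOK table (⟨4, 0⟩ : (Zsqrtd 3)) = true := by decide +kernel

set_option maxRecDepth 100000 in
/-- Kernel check (the distance distribution): the dot products of every member with the other members
have exactly the tabulated multiplicities and take no other value. -/
private theorem hist_vecs : histOK vecs table vecs = true := by decide +kernel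

/-- The coordinate lists are pairwise distinct (from the checks). -/
private theorem nodup_vecs : vecs.Nodup := nodup_of_checks shape_vecs keys_table hist_vecs


/-- The configuration: the normalised coordinate lists as points of `ℝ^2`. -/
noncomputable def pts : Finset (EuclideanSpace ℝ (Fin 2)) := config (Zsqrtd.toReal h3) 2 (⟨4, 0⟩ : (Zsqrtd 3)) vecs

/-- `ι q > 0`. -/
private theorem hq : 0 < (Zsqrtd.toReal h3) (⟨4, 0⟩ : (Zsqrtd 3)) := by
  rw [Zsqrtd.toReal_apply]; push_cast; nlinarith [Real.sqrt_nonneg 3, hX]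

/-- Node value `ι d / ι q` for the table key number `0`. -/
private theorem key_0 : (Zsqrtd.toReal h3) (⟨-4, 0⟩ : (Zsqrtd 3)) / (Zsqrtd.toReal h3) (⟨4, 0⟩ : (Zsqrtd 3)) = (-1 : ℝ) := by
  rw [div_eq_iff hq.ne', Zsqrtd.toReal_apply, Zsqrtd.toReal_apply]
  push_cast
  linear_combination (0 : ℝ) * hX

/-- Node value `ι d / ι q` for the table key number `1`. -/
private theorem key_1 : (Zsqrtd.toReal h3) (⟨-2, 0⟩ : (Zsqrtd 3)) / (Zsqrtd.toReal h3) (⟨4, 0⟩ : (Zsqrtd 3)) = (-1 / 2 : ℝ) := by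
  rw [div_eq_iff hq.ne', Zsqrtd.toReal_apply, Zsqrtd.toReal_apply]
  push_cast
  linear_combination (0 : ℝ) * hX

/-- Node value `ι d / ι q` for the table key number `2`. -/
private theorem key_2 : (Zsqrtd.toReal h3) (⟨2, 0⟩ : (Zsqrtd 3)) / (Zsqrtd.toReal h3) (⟨4, 0⟩ : (Zsqrtd 3)) = (1 / 2 : ℝ) := by
  rw [div_eq_iff hq.ne', Zsqrtd.toReal_apply, Zsqrtd.toReal_apply]
  push_cast
  linear_combination (0 : ℝ) * hX

/-- `pts` has `6` points. -/
theorem card_pts : pts.card = 6 := by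
  rw [pts, card_eq (Zsqrtd.toReal_injective h3 d3_not_square) hq shape_vecs keys_table hist_vecs nodup_vecs, length_vecs]

/-- Every point of `pts` is a unit vector. -/
private theorem norm_pts : ∀ x ∈ pts, ‖x‖ = 1 := norm_eq_one hq shape_vecs

/-- Distinct points of `pts` have inner product `ι d / ι q` for a key `d` of the table. -/
private theorem inner_pts : ∀ x ∈ pts, ∀ y ∈ pts, x ≠ y → ∃ p ∈ table, inner ℝ x y = (Zsqrtd.toReal h3) p.1 / (Zsqrtd.toReal h3) (⟨4, 0⟩ : (Zsqrtd 3)) :=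
  inner_mem hq shape_vecs hist_vecs

/-- **Energy of the configuration**: for every potential `a`, `Σ_{x ≠ y ∈ pts} a(⟪x,y⟫)` equals the
tabulated value. -/
theorem energy_pts (a : ℝ → ℝ) :
    ∑ x ∈ pts, ∑ y ∈ pts.erase x, a (inner ℝ x y) =
      (6 : ℝ) * (a (-1) + 2 * a (-1 / 2) + 2 * a (1 / 2)) := by
  rw [pts, energy_eq (Zsqrtd.toReal_injective h3 d3_not_square) hq shape_vecs keys_table hist_vecs nodup_vecs a, length_vecs]
  simp only [table, List.map_cons, List.map_nil, List.sum_cons, List.sum_nil, Nat.cast_ofNat, Nat.cast_one]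
  rw [key_0, key_1, key_2]
  ring

/-- **Ground-state energy of `6` points on `S¹`** for every absolutely monotonic potential: the regular hexagon (universal optimality lower bound + attained). [cite: CohnKumar2006, Theorem 1.2] -/
theorem energy_isLeast (a : ℝ → ℝ) (ha : AbsolutelyMonotoneOn a (Set.Ico (-1) 1)) :
    IsLeast {E : ℝ | ∃ C : Finset (EuclideanSpace ℝ (Fin 2)), (∀ x ∈ C, ‖x‖ = 1) ∧ C.card = 6 ∧
      E = ∑ x ∈ C, ∑ y ∈ C.erase x, a (inner ℝ x y)}
      ((6 : ℝ) * (a (-1) + 2 * a (-1 / 2) + 2 * a (1 / 2))) := by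
  refine ⟨⟨pts, norm_pts, card_pts, (energy_pts a).symm⟩, ?_⟩
  rintro E ⟨C, h1, hN, rfl⟩
  exact Energy.UniversalPolygon6.universallyOptimal_of_absolutelyMonotoneOn a ha C h1 hN

end Summit.Ventures.PackingBounds.Config.Hexagon
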